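import Summits.BirchSwinnertonDyer.BirchSwinnertonDyer.Theorems.KolyvaginDepthDoorMSymbolCert794a1OddCheck
import Summits.BirchSwinnertonDyer.BirchSwinnertonDyer.Theorems.KolyvaginDepthDoorMSymbolCert997b1Twist
import Summits.BirchSwinnertonDyer.BirchSwinnertonDyer.Theorems.KolyvaginDepthDoorDepthTableRankTwo794a1TwistBSDQuotient
import Summits.BirchSwinnertonDyer.BirchSwinnertonDyer.Theorems.KolyvaginDepthDoorDepthTableRows5
import Summits.BirchSwinnertonDyer.BirchSwinnertonDyer.Theorems.KatoDescentTamePotSupersingularTameUpperUnitTwistRecordToolsConductor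
import Literature.NumberTheory.EllipticCurves.CuspFormTwistRatPlusSymbolOdd
import Literature.NumberTheory.EllipticCurves.QuadraticTwistKroneckerLFunctionProofs
import Literature.NumberTheory.QuadraticFields.JacobiCharacterPrimitiveProofs
import Literature.NumberTheory.EllipticCurves.LFunctionSmulProofs
import Literature.NumberTheory.EllipticCurves.ModularityVersionApProofs
import HarnessLib

/-!
# Route `KolyvaginDepthDoor`, crux `KolyvaginDepthSupplyKN` (stmt-BirchSwinnertonDyer-22820) —
# DEPTH TABLE v28, TWIST SIDE of the COMPOSITE-conductor row `794a1` @ `(7, −23)`: the plus symbols of the newform of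
# `T₀ = 794a1 ⊗ χ₋₂₃` (conductor `420026 = 2·23²·397`) from the CERTIFIED minus M-symbol of `794a1` (pair-indexed level `794`)

Helper file of the lead prover of line `levelone` (kdd-p1 g33; `--supports stmt-BirchSwinnertonDyer-22820
--as helper`); it closes nothing and BSD is NOT proved by it. Sibling of `…MSymbolCert997b1Twist` (same argument, `χ₋₂₃` lemmas
imported from there), with the minus symbols of `f₀` read through kit 5′ (`chainSumC 2 397`):
* `conductorNorm_T0`: `N_{T₀} = 420026` for the tree's twist model `T₀ = [1,-1,0,-2215,-35567]` (`C794a1.minTwist23_*`, g19)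
  (kernel: Tate exponents `f₂ = 1`, `f₂₃ = 2`, `f₂₂₃ = 1` from `Δ(T₀) = 2²·23⁶·397`, `c₄ = 64009`);
* `LFunction_T0`: `aₙ(T₀) = (n/23) aₙ(794a1)`, `newform_T0_eq_charTwist`;
* `exists_ratMinusSymbol_const`, `exists_const_T0`: `[a/197]⁺_g = C · sigmaT a` (`197` the cyclic Kolyvagin prime of `C794a1.cruxBody_of_unit_197`).

References: [MazurTateTeitelbaum1986Invent] §I.8; [Shimura1971] Prop. 3.64; [CremonaAlgorithms1997] §2.8, Table 1 (794a1);
[SilvermanAEC2009] App. C §16, X.5 Cor. 5.4.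
-/

set_option linter.dupNamespace false

noncomputable section

open scoped MatrixGroups ModularForm
open CongruenceSubgroup
open Literature.NumberTheory.EllipticCurves Literature.NumberTheory.EllipticCurves.ModularForms
open Literature.NumberTheory.QuadraticFields
open Summit.BirchSwinnertonDyer.BirchSwinnertonDyer.Rank2Observatory
open Summit.BirchSwinnertonDyer.BirchSwinnertonDyer.Theorems.TameUpperUnitTwistRecords
  (conductorNorm_eq_of_exponents conductorExponent_natPlace_eq_two_of_five_le
    conductorExponent_natPlace_eq_one_of_dvd_of_not_dvd)
open Summit.BirchSwinnertonDyer.BirchSwinnertonDyer.Rank1Residual (IntModel.frobeniusTrace_eq IntModel.minimalDiscriminantInt_eq)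
open Summit.BirchSwinnertonDyer.BirchSwinnertonDyer.Theorems.KolyvaginDepthDoor.MSymbolCert.Cert997b1
  (jacobiChar_23_odd jacobiChar_23_isPrimitive jac23 jac23_eq)
open Summit.BirchSwinnertonDyer.BirchSwinnertonDyer.Theorems.KolyvaginDepthDoor (C794a1.minTwist23_isElliptic
  C794a1.minTwist23_isGloballyMinimal C794a1.minTwist23_intModel C794a1.minTwist23_smul_eq)

namespace Summit.BirchSwinnertonDyer.BirchSwinnertonDyer.Theorems.KolyvaginDepthDoor.MSymbolCert.Cert794a1

/-! ## §1 `T₀` and its conductor -/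

/-- The globally minimal model `T₀` of `794a1^{(-23)}` (`C794a1.minTwist23_*`). [cite: CremonaAlgorithms1997, Table 1 (794a1)] -/
abbrev T0 : WeierstrassCurve ℚ := (⟨1, 0, 1, -1334, -30036⟩ : WeierstrassCurve ℤ).map (Int.castRingHom ℚ)

/-- **`N(T₀) = 420026 = 2 · 23² · 397`** (kernel: `Δ(T₀) = 2²·23⁶·397`; `2 ∤ c₄`, `397 ∤ c₄` (multiplicative, `f = 1`), `23 ∣ c₄`
(`f₂₃ = 2`)). [cite: SilvermanAEC2009, App. C §16] -/
theorem conductorNorm_T0 : haveI := C794a1.minTwist23_isElliptic; T0.conductorNorm ℤ = 420026 := by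
  haveI := C794a1.minTwist23_isElliptic
  haveI := C794a1.minTwist23_isGloballyMinimal
  have hI := C794a1.minTwist23_intModel
  have h := conductorNorm_eq_of_exponents hI (G := [(2, 2), (23, 6), (397, 1)]) (by decide +kernel)
    (by intro qe hqe; simp only [List.mem_cons, List.not_mem_nil, or_false] at hqe
        rcases hqe with rfl | rfl | rfl <;> norm_num)
    [(2, 1), (23, 2), (397, 1)]
    (by intro qf hqf; simp only [List.mem_cons, List.not_mem_nil, or_false] at hqf
        rcases hqf with rfl | rfl | rfl <;> norm_num)
    (by decide) (by decide)
    (by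
      intro qf hqf
      simp only [List.mem_cons, List.not_mem_nil, or_false] at hqf
      rcases hqf with rfl | rfl | rfl
      · exact conductorExponent_natPlace_eq_one_of_dvd_of_not_dvd hI (by norm_num) (by decide +kernel) (by decide +kernel)
      · exact conductorExponent_natPlace_eq_two_of_five_le hI (by norm_num) (by norm_num) (n := 6) (by norm_num)
          (by decide +kernel) (by decide +kernel) (by norm_num) (by decide +kernel)
      · exact conductorExponent_natPlace_eq_one_of_dvd_of_not_dvd hI (by norm_num) (by decide +kernel) (by decide +kernel))
  rw [h]; norm_num

/-! ## §2 The Dirichlet coefficients of `T₀` -/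

/-- **`aₙ(T₀) = (n/23) · aₙ(794a1)`** (`T₀ ≅ 794a1^{(-23)}` by `C794a1.minTwist23_smul_eq`; `794a1` good at `23`).
[cite: SilvermanAEC2009, X.5 Cor. 5.4] -/
theorem LFunction_T0 (n : ℕ) :
    haveI := C794a1.minTwist23_isElliptic; haveI := isElliptic_c794a1;
    (T0.LFunction n : ℂ) = jacobiChar 23 n * ((((⟨1, 0, 1, -3, 2⟩ : WeierstrassCurve ℤ).map (Int.castRingHom ℚ))).LFunction n : ℂ) := by
  haveI := C794a1.minTwist23_isElliptic
  haveI := isElliptic_c794a1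
  haveI := isGloballyMinimal_c794a1
  have hsmul := WeierstrassCurve.LFunction_smul T0 (⟨1, (-2 : ℚ), -((1 : ℚ) / 2), ((1 : ℚ) / 2)⟩ : WeierstrassCurve.VariableChange ℚ)
  rw [C794a1.minTwist23_smul_eq] at hsmul
  have hgood : ∀ v : IsDedekindDomain.HeightOneSpectrum (NumberField.RingOfIntegers ℚ),
      ((Rat.HeightOneSpectrum.primesEquiv v : ℕ) : ℤ) ∣ (-23 : ℤ) → (((⟨1, 0, 1, -3, 2⟩ : WeierstrassCurve ℤ).map (Int.castRingHom ℚ))).HasGoodReductionAt v := by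
    intro v hv
    by_contra hbad
    have hdvdN : (Rat.HeightOneSpectrum.primesEquiv v : ℕ) ∣ (((⟨1, 0, 1, -3, 2⟩ : WeierstrassCurve ℤ).map (Int.castRingHom ℚ))).conductorNorm ℤ :=
      ((((⟨1, 0, 1, -3, 2⟩ : WeierstrassCurve ℤ).map (Int.castRingHom ℚ))).dvd_conductorNorm_iff v).mpr hbad
    rw [C794a1.conductorNorm_eq] at hdvdN
    have hq : (Rat.HeightOneSpectrum.primesEquiv v : ℕ) ∣ 23 := by
      have : ((Rat.HeightOneSpectrum.primesEquiv v : ℕ) : ℤ) ∣ ((23 : ℕ) : ℤ) := by simpa using hv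
      exact_mod_cast this
    have hp := (Rat.HeightOneSpectrum.primesEquiv v).2
    have hq' : (Rat.HeightOneSpectrum.primesEquiv v : ℕ) = 23 :=
      (Nat.prime_dvd_prime_iff_eq hp (by norm_num)).mp hq
    rw [hq'] at hdvdN
    norm_num at hdvdN
  have hsq : Squarefree (-23 : ℤ) := by
    rw [← Int.squarefree_natAbs]
    exact (Nat.prime_iff.mp (by norm_num : Nat.Prime 23)).squarefree
  have htw := (((⟨1, 0, 1, -3, 2⟩ : WeierstrassCurve ℤ).map (Int.castRingHom ℚ))).LFunction_quadraticTwist_apply_of_emod_four_eq_one (D := -23) (by decide) hsq hgood n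
  rw [show (((-23 : ℤ) : ℚ)) = (-23 : ℚ) by norm_num] at htw
  rw [← hsmul, htw, jacobiChar_natCast]
  push_cast
  rfl

/-! ## §3 The newform of `T₀` is the twist of the newform of `794a1` -/

/-- `2·397 ∣ 420026`. [folklore] -/
theorem dvd_420026 : 2 * 397 ∣ 420026 := by norm_num

/-- `23² ∣ 420026`. [folklore] -/
theorem sq_dvd_420026 : 23 ^ 2 ∣ 420026 := by norm_num

/-- **The newform of `T₀` at level `420026` is `f₀ ⊗ χ₋₂₃`** for the newform `f₀` of `794a1` at level `2·397`.
[cite: Shimura1971, Prop. 3.64] -/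
theorem newform_T0_eq_charTwist (f₀ : CuspForm (Gamma0 (2 * 397)) 2)
    (hf₀ : haveI := isElliptic_c794a1; IsNewformOf (((⟨1, 0, 1, -3, 2⟩ : WeierstrassCurve ℤ).map (Int.castRingHom ℚ))) f₀)
    (g : CuspForm (Gamma0 420026) 2) (hg : haveI := C794a1.minTwist23_isElliptic; IsNewformOf T0 g) :
    g = charTwist 420026 dvd_420026 sq_dvd_420026 (isQuadratic_jacobiChar (q := 23)) f₀ := by
  haveI := isElliptic_c794a1
  refine eq_of_forall_cuspCoeff_eq_gamma0 fun n => ?_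
  rw [cuspCoeff_charTwist _ _ _ _ jacobiChar_23_isPrimitive, hf₀.2 n, hg.2 n, LFunction_T0]

/-! ## §4 The minus symbols of the newform of `794a1` (pair-indexed certified odd eigenvector) -/

/-- `T_3 f₀ = -2 f₀` for the newform of `794a1` at level `2·397` (`#Ẽ(𝔽_3) = 6`). [cite: CremonaAlgorithms1997, Table 1 (794a1)] -/
theorem heckeT3_of_isNewformOf (f₀ : CuspForm (Gamma0 (2 * 397)) 2)
    (hf₀ : haveI := isElliptic_c794a1; IsNewformOf (((⟨1, 0, 1, -3, 2⟩ : WeierstrassCurve ℤ).map (Int.castRingHom ℚ))) f₀) :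
    heckeTnGamma0 (2 * 397) 2 3 f₀ = ((-2 : ℝ) : ℂ) • f₀ := by
  haveI : Fact (Nat.Prime 3) := ⟨by norm_num⟩
  haveI : NeZero (3 : ℕ) := ⟨by norm_num⟩
  haveI := isElliptic_c794a1
  haveI := isGloballyMinimal_c794a1
  have hgood : (((⟨1, 0, 1, -3, 2⟩ : WeierstrassCurve ℤ).map (Int.castRingHom ℚ))).HasGoodReductionAtPrime 3 :=
    WeierstrassCurve.hasGoodReductionAtPrime_of_not_dvd _ 3
      (by rw [IntModel.minimalDiscriminantInt_eq C794a1.intModel]; decide +kernel)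
  have hc : cuspCoeff f₀ 3 = ((((⟨1, 0, 1, -3, 2⟩ : WeierstrassCurve ℤ).map (Int.castRingHom ℚ))).frobeniusTrace 3 : ℂ) :=
    cuspCoeff_eq_frobeniusTrace_of_isNewformOf_holds hf₀ hgood
  have htr : (((⟨1, 0, 1, -3, 2⟩ : WeierstrassCurve ℤ).map (Int.castRingHom ℚ))).frobeniusTrace 3 = -2 := by
    rw [IntModel.frobeniusTrace_eq C794a1.intModel C794a1.card_3]; norm_num
  rw [heckeTnGamma0_prime (2 * 397) 2 3 (by norm_num), IsNewform0.heckeT_eq_coeff_smul hf₀.1 (by norm_num),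
    show (PowerSeries.coeff 3) (UpperHalfPlane.qExpansion 1 ⇑f₀) = cuspCoeff f₀ 3 from rfl, hc, htr]
  push_cast
  rfl

/-- `T_5 f₀ = -4 f₀` for the newform of `794a1` at level `2·397` (`#Ẽ(𝔽_5) = 10`). [cite: CremonaAlgorithms1997, Table 1 (794a1)] -/
theorem heckeT5_of_isNewformOf (f₀ : CuspForm (Gamma0 (2 * 397)) 2)
    (hf₀ : haveI := isElliptic_c794a1; IsNewformOf (((⟨1, 0, 1, -3, 2⟩ : WeierstrassCurve ℤ).map (Int.castRingHom ℚ))) f₀) :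
    heckeTnGamma0 (2 * 397) 2 5 f₀ = ((-4 : ℝ) : ℂ) • f₀ := by
  haveI : Fact (Nat.Prime 5) := ⟨by norm_num⟩
  haveI : NeZero (5 : ℕ) := ⟨by norm_num⟩
  haveI := isElliptic_c794a1
  haveI := isGloballyMinimal_c794a1
  have hgood : (((⟨1, 0, 1, -3, 2⟩ : WeierstrassCurve ℤ).map (Int.castRingHom ℚ))).HasGoodReductionAtPrime 5 :=
    WeierstrassCurve.hasGoodReductionAtPrime_of_not_dvd _ 5
      (by rw [IntModel.minimalDiscriminantInt_eq C794a1.intModel]; decide +kernel)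
  have hc : cuspCoeff f₀ 5 = ((((⟨1, 0, 1, -3, 2⟩ : WeierstrassCurve ℤ).map (Int.castRingHom ℚ))).frobeniusTrace 5 : ℂ) :=
    cuspCoeff_eq_frobeniusTrace_of_isNewformOf_holds hf₀ hgood
  have htr : (((⟨1, 0, 1, -3, 2⟩ : WeierstrassCurve ℤ).map (Int.castRingHom ℚ))).frobeniusTrace 5 = -4 := by
    rw [IntModel.frobeniusTrace_eq C794a1.intModel C794a1.card_5]; norm_num
  rw [heckeTnGamma0_prime (2 * 397) 2 5 (by norm_num), IsNewform0.heckeT_eq_coeff_smul hf₀.1 (by norm_num),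
    show (PowerSeries.coeff 5) (UpperHalfPlane.qExpansion 1 ⇑f₀) = cuspCoeff f₀ 5 from rfl, hc, htr]
  push_cast
  rfl

/-- **`[y]⁻_{f₀} ∈ K₀ ℤ` and `[a/n]⁻_{f₀} = K₀ · S⁻(a/n)`** for the newform `f₀` of `794a1` at level `2·397`, ONE rational `K₀`
(certified odd eigenvector, kit 5′). [cite: MazurTateTeitelbaum1986Invent, §I.8] -/
theorem exists_ratMinusSymbol_const (f₀ : CuspForm (Gamma0 (2 * 397)) 2)
    (hf₀ : haveI := isElliptic_c794a1; IsNewformOf (((⟨1, 0, 1, -3, 2⟩ : WeierstrassCurve ℤ).map (Int.castRingHom ℚ))) f₀) :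
    ∃ K₀ : ℚ, (∀ y : ℚ, ∃ k : ℤ, ratMinusSymbol f₀ y = K₀ * k) ∧
      ∀ (a w : ℤ) (n : ℕ), 0 < n → a * w % n = 1 → ∀ fuel : ℕ, n < fuel →
        ratMinusSymbol f₀ ((a : ℚ) / n) = K₀ * chainSumC 2 397 phim794a1 fuel n w := by
  haveI := isElliptic_c794a1
  have hreal : ∀ m, (cuspCoeff f₀ m).im = 0 := cuspCoeff_im_eq_zero_of_coeffField_eq_bot hf₀.coeffField_eq_bot
  have hF : ∀ k < 5970, eval (ΨmC f₀) (genOdd794a1 k) = 0 := fun k _ =>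
    poolOdd_holds f₀ hreal (heckeT3_of_isNewformOf f₀ hf₀) (heckeT5_of_isNewformOf f₀ hf₀) k
  obtain ⟨t, ht⟩ := exists_eq_smul_of_checkF certOdd794a1 genOdd794a1 5970 1194 phim794a1 certOdd794a1_check (ΨmC f₀) hF
  obtain ⟨g, ε, hg, hε, hval⟩ :=
    exists_ratMinusSymbol_eqC f₀ hf₀.1 hf₀.coeffField_eq_bot (fun i hi => ht i (by norm_num at hi; omega))
  refine ⟨(ε : ℚ) / (2 * g), fun y => ?_, fun a w n hn hw fuel hfuel => by rw [hval a w n hn hw fuel hfuel]; ring⟩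
  by_cases hden : y.den = 1
  · refine ⟨0, ?_⟩
    have hy : y = ((y.num : ℚ)) := by
      conv_lhs => rw [← Rat.num_div_den y]
      rw [hden]; simp
    rw [hy, show ((y.num : ℚ)) = 0 + (y.num : ℚ) by ring, ratMinusSymbol_add_intCast, ratMinusSymbol_zero]
    simp
  · have hcop : IsCoprime y.num (y.den : ℤ) := by
      rw [Int.isCoprime_iff_gcd_eq_one]
      exact y.reduced
    obtain ⟨u, v, huv⟩ := hcop
    have hden1 : (1 : ℤ) < y.den := by
      have := y.den_pos
      omega
    have hw : y.num * u % (y.den : ℤ) = 1 := by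
      have : y.num * u = 1 + (y.den : ℤ) * (-v) := by linarith
      rw [this, Int.add_mul_emod_self_left, Int.emod_eq_of_lt (by norm_num) hden1]
    refine ⟨chainSumC 2 397 phim794a1 (y.den + 1) y.den u, ?_⟩
    have h := hval y.num u y.den y.den_pos hw (y.den + 1) (by omega)
    rw [Rat.num_div_den] at h
    rw [h]
    ring

/-! ## §5 The plus symbols of the newform of `T₀` at the cusps `a/197` -/

/-- The Bezout witness `(23a + 71u)^{769} mod 4531`. [folklore] -/
def bezT (a u : ℕ) : ℤ := (((23 * a + 197 * u) ^ 2155 % 4531 : ℕ) : ℤ)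

/-- The kernel's twisted minus sum at `r = a/197` (pair-indexed chains at level `794`): `∑_{u=1}^{22} (u/23) · S⁻((23a + 71u)/4531)`.
[cite: MazurTateTeitelbaum1986Invent, §I.8] -/
def sigmaT (a : ℕ) : ℤ :=
  ∑ u : ZMod 23, (if u.val = 0 then 0 else jac23 u.val * chainSumC 2 397 phim794a1 4532 4531 (bezT a u.val))

set_option maxHeartbeats 4000000 in
/-- Bezout data at `4531 = 23 · 71` (decide). [folklore] -/
theorem bezout_4531 : ∀ a < 197, Nat.Coprime a 197 → ∀ u < 23, u ≠ 0 →
    (((23 * a + 197 * u : ℕ) : ℤ) * bezT a u) % 4531 = 1 := by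
  unfold bezT
  decide +kernel

/-- A modular parametrisation newform of `794a1` at level `2·397` exists, granted modularity BY NAME. [cite: BreuilConradDiamondTaylor2001, Thm. A] -/
theorem exists_newform_794a1 (hnf : exists_isNewformOf) :
    haveI := isElliptic_c794a1;
    ∃ f₀ : CuspForm (Gamma0 (2 * 397)) 2, IsNewformOf (((⟨1, 0, 1, -3, 2⟩ : WeierstrassCurve ℤ).map (Int.castRingHom ℚ))) f₀ := by
  haveI := isElliptic_c794a1
  haveI : NeZero ((((⟨1, 0, 1, -3, 2⟩ : WeierstrassCurve ℤ).map (Int.castRingHom ℚ))).conductorNorm ℤ) := neZero_conductorNorm_of_isElliptic _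
  suffices h : ∀ L : ℕ, L = (((⟨1, 0, 1, -3, 2⟩ : WeierstrassCurve ℤ).map (Int.castRingHom ℚ))).conductorNorm ℤ → ∀ [NeZero L],
      ∃ f₀ : CuspForm (Gamma0 L) 2, IsNewformOf (((⟨1, 0, 1, -3, 2⟩ : WeierstrassCurve ℤ).map (Int.castRingHom ℚ))) f₀ from
    h (2 * 397) (C794a1.conductorNorm_eq.trans (by norm_num)).symm
  intro L hL _
  subst hL
  exact hnf _

/-- **The plus symbols of the newform `g` of `T₀` at level `420026`**: ONE rational `C` with `[r]⁺_g ∈ C ℤ` for all `r` and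
`[a/197]⁺_g = C · sigmaT a` for `0 < a < 197`. [cite: MazurTateTeitelbaum1986Invent, §I.8] [cite: Shimura1971, Prop. 3.64] -/
theorem exists_const_T0 (hnf : exists_isNewformOf) (g : CuspForm (Gamma0 420026) 2)
    (hg : haveI := C794a1.minTwist23_isElliptic; IsNewformOf T0 g) :
    ∃ C : ℚ, (∀ r : ℚ, ∃ m : ℤ, ratPlusSymbol g r = C * m) ∧
      ∀ a < 197, Nat.Coprime a 197 → ratPlusSymbol g ((a : ℚ) / 197) = C * sigmaT a := by
  haveI := C794a1.minTwist23_isElliptic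
  haveI := isElliptic_c794a1
  obtain ⟨f₀, hf₀⟩ := exists_newform_794a1 hnf
  have hgF := newform_T0_eq_charTwist f₀ hf₀ g hg
  set F := charTwist 420026 dvd_420026 sq_dvd_420026 (isQuadratic_jacobiChar (q := 23)) f₀ with hFdef
  have hF : IsNewform0 F := hgF ▸ hg.1
  have hQF : coeffField F = ⊥ := hgF ▸ hg.coeffField_eq_bot
  obtain ⟨c, hc, -⟩ := exists_rat_forall_ratPlusSymbol_charTwist_eq_of_odd 420026 dvd_420026 sq_dvd_420026
    (isQuadratic_jacobiChar (q := 23)) jacobiChar_23_odd jacobiChar_23_isPrimitive hf₀.1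
    hf₀.coeffField_eq_bot hF hQF (fun u : ZMod 23 => jacobiSym (u.val : ℤ) 23) (fun u => jacobiChar_apply u)
  obtain ⟨K₀, hK₀all, hK₀val⟩ := exists_ratMinusSymbol_const f₀ hf₀
  refine ⟨c * K₀, fun r => ?_, fun a ha hac => ?_⟩
  · choose k hk using hK₀all
    refine ⟨∑ u : ZMod 23, jacobiSym (u.val : ℤ) 23 * k (r + twistShift u), ?_⟩
    rw [hgF, hc r]
    push_cast
    rw [Finset.mul_sum, Finset.mul_sum]
    refine Finset.sum_congr rfl fun u _ => ?_
    rw [hk (r + twistShift u)]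
    ring
  · rw [hgF, hc ((a : ℚ) / 197)]
    have hterm : ∀ u : ZMod 23, (jacobiSym (u.val : ℤ) 23 : ℚ) * ratMinusSymbol f₀ ((a : ℚ) / 197 + twistShift u) =
        K₀ * ((if u.val = 0 then 0 else jac23 u.val * chainSumC 2 397 phim794a1 4532 4531 (bezT a u.val) : ℤ) : ℚ) := by
      intro u
      have hu23 : u.val < 23 := ZMod.val_lt u
      by_cases hu : u.val = 0
      · rw [hu, if_pos rfl]
        simp [jacobiSym.zero_left]
      · rw [if_neg hu, jac23_eq u.val hu23]
        have hbez := bezout_4531 a ha hac u.val hu23 hu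
        have hval := hK₀val ((23 * a + 197 * u.val : ℕ) : ℤ) (bezT a u.val) 4531 (by norm_num) hbez 4532 (by norm_num)
        have hr : (a : ℚ) / 197 + twistShift u = (((23 * a + 197 * u.val : ℕ) : ℤ) : ℚ) / (4531 : ℕ) := by
          rw [twistShift]
          push_cast
          field_simp
          ring
        rw [hr, hval]
        push_cast
        ring
    rw [Finset.sum_congr rfl fun u _ => hterm u, ← Finset.mul_sum, sigmaT, Int.cast_sum]
    ring

end Summit.BirchSwinnertonDyer.BirchSwinnertonDyer.Theorems.KolyvaginDepthDoor.MSymbolCert.Cert794a1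

end
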